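import Summits.ResolutionOfSingularities.ResolutionOfSingularities.Theorems.WildQuotientsGaloisReductionOfDeJong1997
import Summits.ResolutionOfSingularities.ResolutionOfSingularities.Theorems.PAlterationAssembly
import HarnessLib

/-!
# `WildQuotients.SummitReduction` (stmt-ResolutionOfSingularities-16324) from de Jong's theorem

Route `ResolutionOfSingularities/WildQuotients`, crux `SummitReduction` (the de Jong REDUCTION,
per prime and summit-concluding): `∀ p, WQ_p → PICover_p → ResolutionInChar p`.

Following the planner's probe (rev 2): `SummitReduction` follows from `∀ p, WQ_p → PIAlt_p` and
pAlteration's PROVED per-prime frame alone —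

* `Theorems.pialtAt_of_deJong1997` (`…WildQuotientsGaloisReductionOfDeJong1997`): `WQ_p → PIAlt_p`,
  CONDITIONAL on the named fact
  `Literature.AlgebraicGeometry.Resolution.DeJong1997_galoisAlterationQuasiProjective` (de Jong
  1997, Thm. 5.13 / Cor. 5.15 — de Jong's theorem);
* `Theorems.hasResolution_of_thesis p` (`…PAlterationAssembly`, Theorem B): `PIAlt_p ∧ PICover_p`
  resolve every INTEGRAL separated scheme of finite type over every field of characteristic `p`;
* `Theses.PAlteration.DescentReducedToIntegral_holds`: reduced → integral.

Results: `summitReduction_of_deJong1997 : DeJong1997_galoisAlterationQuasiProjective →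
SummitReduction`, and the route modulo de Jong's theorem,
`resolutionOfSingularities_of_deJong1997 : DeJong1997_galoisAlterationQuasiProjective →
WildQuotientResolution → Picover → ResolutionOfSingularities` (the deciding theorem `closes` with
`SummitReduction` discharged): the route is conditional on de Jong's theorem and its two open
cruxes only. Filed `--supports` the crux (it does not close it: the named fact is a hypothesis).
-/

-- single-problem summit: the doubled namespace component `ResolutionOfSingularities` is forced
set_option linter.dupNamespace false

noncomputable section

open CategoryTheory AlgebraicGeometry

namespace Summit.ResolutionOfSingularities.ResolutionOfSingularities.Theorems

open Literature.AlgebraicGeometry.Resolution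

/-- **`SummitReduction` (stmt-ResolutionOfSingularities-16324) from de Jong's theorem**: for every
prime `p`, `WQ_p → PICover_p → ResolutionInChar p` — reduced → integral
(`PAlteration.DescentReducedToIntegral_holds`), integral by pAlteration's Theorem B
(`hasResolution_of_thesis p`) fed with `PIAlt_p` from `WQ_p` (`pialtAt_of_deJong1997`, de Jong's
reduction) and the given `PICover_p`. CONDITIONAL on the named fact
`DeJong1997_galoisAlterationQuasiProjective` (de Jong 1997, Thm. 5.13 / Cor. 5.15) only.
[cite: DeJong1997, Thm. 5.13, Cor. 5.15, pp. 619–620] -/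
theorem summitReduction_of_deJong1997 (hdJ : DeJong1997_galoisAlterationQuasiProjective.{0}) :
    Theses.WildQuotients.SummitReduction := by
  intro p hp hWQ hPC k _ _ X f hs hl hq hred
  haveI : Fact p.Prime := ⟨hp⟩
  refine Theses.PAlteration.DescentReducedToIntegral_holds k (fun Y g hs' hl' hq' hi' => ?_)
    X f hs hl hq hred
  haveI := hs'
  haveI := hl'
  haveI := hq'
  haveI := hi'
  exact hasResolution_of_thesis p (pialtAt_of_deJong1997 hdJ hp hWQ) hPC g

/-- **The route `WildQuotients` modulo de Jong's theorem**: resolution of Galois-type quotients of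
regular varieties (`WildQuotientResolution`) and of finite radicial covers of regular varieties
(`Picover`) imply resolution of singularities in every positive characteristic — the route's
deciding theorem `Theses.WildQuotients.closes` with its third hypothesis `SummitReduction`
discharged by `summitReduction_of_deJong1997`. CONDITIONAL on
`DeJong1997_galoisAlterationQuasiProjective` (de Jong's theorem); the two remaining hypotheses are
the route's open cruxes. [cite: DeJong1997, Cor. 5.15] -/
theorem resolutionOfSingularities_of_deJong1997
    (hdJ : DeJong1997_galoisAlterationQuasiProjective.{0})
    (hWQ : Theses.WildQuotients.WildQuotientResolution) (hPc : Theses.WildQuotients.Picover) :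
    _root_.ResolutionOfSingularities :=
  Theses.WildQuotients.closes hWQ hPc (summitReduction_of_deJong1997 hdJ)

end Summit.ResolutionOfSingularities.ResolutionOfSingularities.Theorems

end
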